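import Summits.CriticalPhenomena.PercolationContinuityZ3.Theorems.Transplant.FKDoubleFanSameTwoCertA
import Summits.CriticalPhenomena.PercolationContinuityZ3.Theorems.Transplant.FKDoubleFanSameTwoCertB1
import Summits.CriticalPhenomena.PercolationContinuityZ3.Theorems.Transplant.FKDoubleFanSameTwoCertB2
import Summits.CriticalPhenomena.PercolationContinuityZ3.Theorems.Transplant.FKDoubleFanNegCorrAdjacent
import HarnessLib

/-!
# Double fans: two spokes of the same apex at rim vertices two apart — final part: `Θ ≥ 0`, the Rayleigh difference, and the measure-level theorem

Helper file (`--supports stmt-CriticalPhenomena-4575`), FK sub-lane `prim-bschramm-fk-3` (gen 22); builds on p205010 (kernel theorem, internal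
audit signed; external expert review pending).  Pure real algebra: no measures, no named facts, no sorries; standard axioms.  Memo
`bschramm/prim-bschramm-fk-3/SAME-TWO.md`.
Assembly.  `Θ(1) = q²(1−q)F₂(u,Ms)F₁(u,Ms)` (the polarized adjacent formula with the middle spokes `M = AC(x)BC(y)` in the suffix;
**`sameTwoTheta_one_nonneg`**), `Θₘ = Σ m_{hh'} h(u)h'(s) ≥ 0` (**`sameTwoThetaMid_nonneg`**, from parts B1/B2 and C), `Θ(0) ≥ 0` (part A); so
`Θ(r₂) ≥ 0` (**`sameTwoTheta_nonneg`**) and by part B **`rayleigh_sameTwo_nonneg`** / **`InKE.rayleigh_sameTwo_nonneg`**: the Rayleigh difference of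
the two `a`-spokes two rim vertices apart is `≥ 0` for every rest in the rim-step closure, `q, x, y, r₁, r₂ ∈ [0,1]`.  Through the cut formula of
`…DoubleFanNegCorr` this is **`negCorr_spokesA_two`** (and `…B…`): `φ(J_{a c_j} ∩ J_{a c_{j+2}}) ≤ φ(J_{a c_j})·φ(J_{a c_{j+2}})` on every weighted double
fan `K₂ ∨ P_{m+1}`, `0 < q ≤ 1` — the first FAR pair of the double-fan programme (memo `RIM-PAIRS.md` §4).
[cite: Grimmett2006, §3.9 eq. (3.94) (pp. 63–64)] [cite: Wagner2006, Conj. 5.3 (p. 13)] [folklore]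
-/

noncomputable section

namespace Summit.CriticalPhenomena.PercolationContinuityZ3.Theorems

namespace FK

namespace ThreeApex

/-! ### `Θ(1)`: the polarized adjacent formula -/

/-- With the second rim edge contracted, `Z^{αβ}` is the adjacent-pair partition function for the suffix `AC(x) BC(y) s`. [folklore] -/
theorem sameTwoZ_r2_one (q x y r₁ : ℝ) (u s : V5) (α β : ℝ) :
    sameTwoZ q x y r₁ 1 u s α β = spokesAZ q r₁ u (conv (edgeAC x) (conv (edgeBC y) s)) α β := by
  simp only [sameTwoZ, spokesAZ, rimStep_one, ← mul_def]
  congr 1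
  ac_rfl

/-- The `r(1−r)`-coefficient of `rayleigh_spokesA_adjacent_eq`: `q²(1−q)·F₂·F₁`. [folklore] -/
theorem spokesA_adjacent_mixed_eq (q : ℝ) (u s : V5) :
    spokesAZ q 0 u s 1 0 * spokesAZ q 1 u s 0 1 + spokesAZ q 1 u s 1 0 * spokesAZ q 0 u s 0 1
      - spokesAZ q 0 u s 1 1 * spokesAZ q 1 u s 0 0 - spokesAZ q 1 u s 1 1 * spokesAZ q 0 u s 0 0 =
      q ^ 2 * (1 - q) * (spokeF2 q u s * spokeF1 q u s) := by
  simp only [spokesAZ, val, conv, edgeAC, rimStep, V5.total, spokeF2, spokeF1]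
  ring

/-- **`Θ(1) = q²(1−q)·F₂(u, Ms)·F₁(u, Ms)`.** [folklore] -/
theorem sameTwoTheta_one_eq (q x y : ℝ) (u s : V5) :
    sameTwoTheta q x y 1 u s =
      q ^ 2 * (1 - q) * (spokeF2 q u (conv (edgeAC x) (conv (edgeBC y) s)) * spokeF1 q u (conv (edgeAC x) (conv (edgeBC y) s))) := by
  unfold sameTwoTheta
  simp only [sameTwoZ_r2_one]
  exact spokesA_adjacent_mixed_eq q u _

/-- `Θ(1) ≥ 0`. [folklore] -/
theorem sameTwoTheta_one_nonneg {q x y : ℝ} (hq0 : 0 ≤ q) (hq1 : q ≤ 1) (hx0 : 0 ≤ x) (hx1 : x ≤ 1) (hy0 : 0 ≤ y) (hy1 : y ≤ 1)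
    {u s : V5} (hu : Valid q u) (hs : Valid q s) : 0 ≤ sameTwoTheta q x y 1 u s := by
  rw [sameTwoTheta_one_eq]
  have hs' : Valid q (conv (edgeAC x) (conv (edgeBC y) s)) :=
    ((IsLetter.ac hx0 hx1).valid hq0 hq1).conv hq0 (((IsLetter.bc hy0 hy1).valid hq0 hq1).conv hq0 hs)
  have h2 := spokeF2_nonneg hq0 hu.nonneg hs'.nonneg
  have h1 := spokeF1_nonneg hq0 hu.nonneg hs'.nonneg
  have hq' : 0 ≤ 1 - q := sub_nonneg.2 hq1
  positivity

/-! ### `Θₘ ≥ 0` and `Θ ≥ 0` -/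

set_option maxHeartbeats 2000000 in
/-- **`Θₘ = Σ_{h,h'} m_{hh'}·h(u)·h'(s)`.** [folklore] -/
theorem sameTwoThetaMid_eq_cert (q x y : ℝ) (u s : V5) :
    sameTwoThetaMid q x y u s =
      s2m_Nbc_Nbc q x y * masterN q (swapAB u) * masterN q (swapAB s)
      + s2m_Nbc_kapC q x y * masterN q (swapAB u) * kap (swapAB s)
      + s2m_Nbc_p0A q x y * masterN q (swapAB u) * (s.z0 * (s.z0 + s.zac))
      + s2m_Nbc_p0B q x y * masterN q (swapAB u) * (s.z0 * (s.zab + s.zbc + s.z1))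
      + s2m_p0A_Nab q x y * (u.z0 * (u.z0 + u.zac)) * masterN q (swapBC s)
      + s2m_p0A_Nbc q x y * (u.z0 * (u.z0 + u.zac)) * masterN q (swapAB s)
      + s2m_p0A_kapB q x y * (u.z0 * (u.z0 + u.zac)) * kap (swapBC s)
      + s2m_p0A_kapC q x y * (u.z0 * (u.z0 + u.zac)) * kap (swapAB s)
      + s2m_p0A_p0A q x y * (u.z0 * (u.z0 + u.zac)) * (s.z0 * (s.z0 + s.zac))
      + s2m_p0A_p0B q x y * (u.z0 * (u.z0 + u.zac)) * (s.z0 * (s.zab + s.zbc + s.z1))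
      + s2m_p0A_pabB q x y * (u.z0 * (u.z0 + u.zac)) * (s.zab * (s.zab + s.zbc + s.z1))
      + s2m_p0A_pbcA q x y * (u.z0 * (u.z0 + u.zac)) * (s.zbc * (s.z0 + s.zac))
      + s2m_p0A_pbcB q x y * (u.z0 * (u.z0 + u.zac)) * (s.zbc * (s.zab + s.zbc + s.z1))
      + s2m_p0B_Nab q x y * (u.z0 * (u.zab + u.zbc + u.z1)) * masterN q (swapBC s)
      + s2m_p0B_Nbc q x y * (u.z0 * (u.zab + u.zbc + u.z1)) * masterN q (swapAB s)
      + s2m_p0B_kapB q x y * (u.z0 * (u.zab + u.zbc + u.z1)) * kap (swapBC s)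
      + s2m_p0B_kapC q x y * (u.z0 * (u.zab + u.zbc + u.z1)) * kap (swapAB s)
      + s2m_p0B_p0A q x y * (u.z0 * (u.zab + u.zbc + u.z1)) * (s.z0 * (s.z0 + s.zac))
      + s2m_p0B_p0B q x y * (u.z0 * (u.zab + u.zbc + u.z1)) * (s.z0 * (s.zab + s.zbc + s.z1))
      + s2m_p0B_pabB q x y * (u.z0 * (u.zab + u.zbc + u.z1)) * (s.zab * (s.zab + s.zbc + s.z1))
      + s2m_p0B_pbcA q x y * (u.z0 * (u.zab + u.zbc + u.z1)) * (s.zbc * (s.z0 + s.zac))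
      + s2m_p0B_pbcB q x y * (u.z0 * (u.zab + u.zbc + u.z1)) * (s.zbc * (s.zab + s.zbc + s.z1))
      + s2m_pabA_Nab q x y * (u.zab * (u.z0 + u.zac)) * masterN q (swapBC s)
      + s2m_pabA_kapB q x y * (u.zab * (u.z0 + u.zac)) * kap (swapBC s)
      + s2m_pabA_p0A q x y * (u.zab * (u.z0 + u.zac)) * (s.z0 * (s.z0 + s.zac))
      + s2m_pabA_p0B q x y * (u.zab * (u.z0 + u.zac)) * (s.z0 * (s.zab + s.zbc + s.z1))
      + s2m_pabA_pabB q x y * (u.zab * (u.z0 + u.zac)) * (s.zab * (s.zab + s.zbc + s.z1))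
      + s2m_pabB_Nab q x y * (u.zab * (u.zab + u.zbc + u.z1)) * masterN q (swapBC s)
      + s2m_pabB_kapB q x y * (u.zab * (u.zab + u.zbc + u.z1)) * kap (swapBC s)
      + s2m_pabB_p0A q x y * (u.zab * (u.zab + u.zbc + u.z1)) * (s.z0 * (s.z0 + s.zac))
      + s2m_pabB_p0B q x y * (u.zab * (u.zab + u.zbc + u.z1)) * (s.z0 * (s.zab + s.zbc + s.z1))
      + s2m_pbcA_Nbc q x y * (u.zbc * (u.z0 + u.zac)) * masterN q (swapAB s)
      + s2m_pbcA_kapC q x y * (u.zbc * (u.z0 + u.zac)) * kap (swapAB s)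
      + s2m_pbcA_p0A q x y * (u.zbc * (u.z0 + u.zac)) * (s.z0 * (s.z0 + s.zac))
      + s2m_pbcA_p0B q x y * (u.zbc * (u.z0 + u.zac)) * (s.z0 * (s.zab + s.zbc + s.z1))
      + s2m_pbcA_pbcB q x y * (u.zbc * (u.z0 + u.zac)) * (s.zbc * (s.zab + s.zbc + s.z1))
      + s2m_pbcB_Nbc q x y * (u.zbc * (u.zab + u.zbc + u.z1)) * masterN q (swapAB s)
      + s2m_pbcB_kapC q x y * (u.zbc * (u.zab + u.zbc + u.z1)) * kap (swapAB s)
      + s2m_pbcB_p0A q x y * (u.zbc * (u.zab + u.zbc + u.z1)) * (s.z0 * (s.z0 + s.zac))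
      + s2m_pbcB_p0B q x y * (u.zbc * (u.zab + u.zbc + u.z1)) * (s.z0 * (s.zab + s.zbc + s.z1)) := by
  rw [sameTwoThetaMid_eq_T]
  simp only [masterN, swapAB, swapBC, kap]
  linear_combination (u.z0 * (u.z0 + u.zac)) * (s.z0 * (s.z0 + s.zac)) * s2Tm_p0A_p0A q x y + (u.z0 * (u.z0 + u.zac)) * (s.zab * (s.z0 + s.zac)) * s2Tm_p0A_pabA q x y + (u.z0 * (u.z0 + u.zac)) * (s.zbc * (s.z0 + s.zac)) * s2Tm_p0A_pbcA q x y + (u.z0 * (u.z0 + u.zac)) * (s.z0 * (s.zab + s.zbc + s.z1)) * s2Tm_p0A_p0B q x y + (u.z0 * (u.z0 + u.zac)) * (s.zab * (s.zab + s.zbc + s.z1)) * s2Tm_p0A_pabB q x y + (u.z0 * (u.z0 + u.zac)) * (s.zbc * (s.zab + s.zbc + s.z1)) * s2Tm_p0A_pbcB q x y + (u.zab * (u.z0 + u.zac)) * (s.z0 * (s.z0 + s.zac)) * s2Tm_pabA_p0A q x y + (u.zab * (u.z0 + u.zac)) * (s.zab * (s.z0 + s.zac)) * s2Tm_pabA_pabA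 q x y + (u.zab * (u.z0 + u.zac)) * (s.zbc * (s.z0 + s.zac)) * s2Tm_pabA_pbcA q x y + (u.zab * (u.z0 + u.zac)) * (s.z0 * (s.zab + s.zbc + s.z1)) * s2Tm_pabA_p0B q x y + (u.zab * (u.z0 + u.zac)) * (s.zab * (s.zab + s.zbc + s.z1)) * s2Tm_pabA_pabB q x y + (u.zab * (u.z0 + u.zac)) * (s.zbc * (s.zab + s.zbc + s.z1)) * s2Tm_pabA_pbcB q x y + (u.zbc * (u.z0 + u.zac)) * (s.z0 * (s.z0 + s.zac)) * s2Tm_pbcA_p0A q x y + (u.zbc * (u.z0 + u.zac)) * (s.zab * (s.z0 + s.zac)) * s2Tm_pbcA_pabA q x y + (u.zbc * (u.z0 + u.zac)) * (s.zbc * (s.z0 + s.zac)) * s2Tm_pbcA_pbcA q x y + (u.zbc * (u.z0 + u.zac)) * (s.z0 * (s.zab + s.zbc + s.z1)) * s2Tm_pbcA_p0B q x y + (u.zbc * (u.z0 + u.zac)) * (s.zab * (s.zab + s.zbc + s.z1)) * s2Tm_pbcA_pabB q x y + (u.zbc * (u.z0 + u.zac)) * (s.zbc * (s.zab + s.zbc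 + s.z1)) * s2Tm_pbcA_pbcB q x y + (u.z0 * (u.zab + u.zbc + u.z1)) * (s.z0 * (s.z0 + s.zac)) * s2Tm_p0B_p0A q x y + (u.z0 * (u.zab + u.zbc + u.z1)) * (s.zab * (s.z0 + s.zac)) * s2Tm_p0B_pabA q x y + (u.z0 * (u.zab + u.zbc + u.z1)) * (s.zbc * (s.z0 + s.zac)) * s2Tm_p0B_pbcA q x y + (u.z0 * (u.zab + u.zbc + u.z1)) * (s.z0 * (s.zab + s.zbc + s.z1)) * s2Tm_p0B_p0B q x y + (u.z0 * (u.zab + u.zbc + u.z1)) * (s.zab * (s.zab + s.zbc + s.z1)) * s2Tm_p0B_pabB q x y + (u.z0 * (u.zab + u.zbc + u.z1)) * (s.zbc * (s.zab + s.zbc + s.z1)) * s2Tm_p0B_pbcB q x y + (u.zab * (u.zab + u.zbc + u.z1)) * (s.z0 * (s.z0 + s.zac)) * s2Tm_pabB_p0A q x y + (u.zab * (u.zab + u.zbc + u.z1)) * (s.zab * (s.z0 + s.zac)) * s2Tm_pabB_pabA q x y + (u.zab * (u.zab + u.zbc + u.z1)) * (s.zbc * (s.z0 + s.zac)) * s2Tm_pabB_pbcA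 q x y + (u.zab * (u.zab + u.zbc + u.z1)) * (s.z0 * (s.zab + s.zbc + s.z1)) * s2Tm_pabB_p0B q x y + (u.zab * (u.zab + u.zbc + u.z1)) * (s.zab * (s.zab + s.zbc + s.z1)) * s2Tm_pabB_pabB q x y + (u.zab * (u.zab + u.zbc + u.z1)) * (s.zbc * (s.zab + s.zbc + s.z1)) * s2Tm_pabB_pbcB q x y + (u.zbc * (u.zab + u.zbc + u.z1)) * (s.z0 * (s.z0 + s.zac)) * s2Tm_pbcB_p0A q x y + (u.zbc * (u.zab + u.zbc + u.z1)) * (s.zab * (s.z0 + s.zac)) * s2Tm_pbcB_pabA q x y + (u.zbc * (u.zab + u.zbc + u.z1)) * (s.zbc * (s.z0 + s.zac)) * s2Tm_pbcB_pbcA q x y + (u.zbc * (u.zab + u.zbc + u.z1)) * (s.z0 * (s.zab + s.zbc + s.z1)) * s2Tm_pbcB_p0B q x y + (u.zbc * (u.zab + u.zbc + u.z1)) * (s.zab * (s.zab + s.zbc + s.z1)) * s2Tm_pbcB_pabB q x y + (u.zbc * (u.zab + u.zbc + u.z1)) * (s.zbc * (s.zab + s.zbc + s.z1)) * s2Tm_pbcB_pbcB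 q x y

set_option maxHeartbeats 2000000 in
/-- **`Θₘ ≥ 0`** for valid `u, s`, `q, x, y ∈ [0,1]`. [folklore] -/
theorem sameTwoThetaMid_nonneg {q x y : ℝ} (hq0 : 0 ≤ q) (hq1 : q ≤ 1) (hx0 : 0 ≤ x) (hx1 : x ≤ 1) (hy0 : 0 ≤ y) (hy1 : y ≤ 1)
    {u s : V5} (hu : Valid q u) (hs : Valid q s) : 0 ≤ sameTwoThetaMid q x y u s := by
  rw [sameTwoThetaMid_eq_cert]
  obtain ⟨⟨hu0, hu1, hu2, hu3, hu4⟩, unac, unab, unbc, ulam, ukA, ukB, ukC⟩ := hu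
  obtain ⟨⟨hs0, hs1, hs2, hs3, hs4⟩, snac, snab, snbc, slam, skA, skB, skC⟩ := hs
  have := s2m_Nbc_Nbc_nonneg hq0 hq1 hx0 hx1 hy0 hy1 (q := q) (x := x) (y := y)
  have := s2m_Nbc_kapC_nonneg hq0 hq1 hx0 hx1 hy0 hy1 (q := q) (x := x) (y := y)
  have := s2m_Nbc_p0A_nonneg hq0 hq1 hx0 hx1 hy0 hy1 (q := q) (x := x) (y := y)
  have := s2m_Nbc_p0B_nonneg hq0 hq1 hx0 hx1 hy0 hy1 (q := q) (x := x) (y := y)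
  have := s2m_p0A_Nab_nonneg hq0 hq1 hx0 hx1 hy0 hy1 (q := q) (x := x) (y := y)
  have := s2m_p0A_Nbc_nonneg hq0 hq1 hx0 hx1 hy0 hy1 (q := q) (x := x) (y := y)
  have := s2m_p0A_kapB_nonneg hq0 hq1 hx0 hx1 hy0 hy1 (q := q) (x := x) (y := y)
  have := s2m_p0A_kapC_nonneg hq0 hq1 hx0 hx1 hy0 hy1 (q := q) (x := x) (y := y)
  have := s2m_p0A_p0A_nonneg hq0 hq1 hx0 hx1 hy0 hy1 (q := q) (x := x) (y := y)
  have := s2m_p0A_p0B_nonneg hq0 hq1 hx0 hx1 hy0 hy1 (q := q) (x := x) (y := y)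
  have := s2m_p0A_pabB_nonneg hq0 hq1 hx0 hx1 hy0 hy1 (q := q) (x := x) (y := y)
  have := s2m_p0A_pbcA_nonneg hq0 hq1 hx0 hx1 hy0 hy1 (q := q) (x := x) (y := y)
  have := s2m_p0A_pbcB_nonneg hq0 hq1 hx0 hx1 hy0 hy1 (q := q) (x := x) (y := y)
  have := s2m_p0B_Nab_nonneg hq0 hq1 hx0 hx1 hy0 hy1 (q := q) (x := x) (y := y)
  have := s2m_p0B_Nbc_nonneg hq0 hq1 hx0 hx1 hy0 hy1 (q := q) (x := x) (y := y)
  have := s2m_p0B_kapB_nonneg hq0 hq1 hx0 hx1 hy0 hy1 (q := q) (x := x) (y := y)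
  have := s2m_p0B_kapC_nonneg hq0 hq1 hx0 hx1 hy0 hy1 (q := q) (x := x) (y := y)
  have := s2m_p0B_p0A_nonneg hq0 hq1 hx0 hx1 hy0 hy1 (q := q) (x := x) (y := y)
  have := s2m_p0B_p0B_nonneg hq0 hq1 hx0 hx1 hy0 hy1 (q := q) (x := x) (y := y)
  have := s2m_p0B_pabB_nonneg hq0 hq1 hx0 hx1 hy0 hy1 (q := q) (x := x) (y := y)
  have := s2m_p0B_pbcA_nonneg hq0 hq1 hx0 hx1 hy0 hy1 (q := q) (x := x) (y := y)
  have := s2m_p0B_pbcB_nonneg hq0 hq1 hx0 hx1 hy0 hy1 (q := q) (x := x) (y := y)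
  have := s2m_pabA_Nab_nonneg hq0 hq1 hx0 hx1 hy0 hy1 (q := q) (x := x) (y := y)
  have := s2m_pabA_kapB_nonneg hq0 hq1 hx0 hx1 hy0 hy1 (q := q) (x := x) (y := y)
  have := s2m_pabA_p0A_nonneg hq0 hq1 hx0 hx1 hy0 hy1 (q := q) (x := x) (y := y)
  have := s2m_pabA_p0B_nonneg hq0 hq1 hx0 hx1 hy0 hy1 (q := q) (x := x) (y := y)
  have := s2m_pabA_pabB_nonneg hq0 hq1 hx0 hx1 hy0 hy1 (q := q) (x := x) (y := y)
  have := s2m_pabB_Nab_nonneg hq0 hq1 hx0 hx1 hy0 hy1 (q := q) (x := x) (y := y)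
  have := s2m_pabB_kapB_nonneg hq0 hq1 hx0 hx1 hy0 hy1 (q := q) (x := x) (y := y)
  have := s2m_pabB_p0A_nonneg hq0 hq1 hx0 hx1 hy0 hy1 (q := q) (x := x) (y := y)
  have := s2m_pabB_p0B_nonneg hq0 hq1 hx0 hx1 hy0 hy1 (q := q) (x := x) (y := y)
  have := s2m_pbcA_Nbc_nonneg hq0 hq1 hx0 hx1 hy0 hy1 (q := q) (x := x) (y := y)
  have := s2m_pbcA_kapC_nonneg hq0 hq1 hx0 hx1 hy0 hy1 (q := q) (x := x) (y := y)
  have := s2m_pbcA_p0A_nonneg hq0 hq1 hx0 hx1 hy0 hy1 (q := q) (x := x) (y := y)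
  have := s2m_pbcA_p0B_nonneg hq0 hq1 hx0 hx1 hy0 hy1 (q := q) (x := x) (y := y)
  have := s2m_pbcA_pbcB_nonneg hq0 hq1 hx0 hx1 hy0 hy1 (q := q) (x := x) (y := y)
  have := s2m_pbcB_Nbc_nonneg hq0 hq1 hx0 hx1 hy0 hy1 (q := q) (x := x) (y := y)
  have := s2m_pbcB_kapC_nonneg hq0 hq1 hx0 hx1 hy0 hy1 (q := q) (x := x) (y := y)
  have := s2m_pbcB_p0A_nonneg hq0 hq1 hx0 hx1 hy0 hy1 (q := q) (x := x) (y := y)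
  have := s2m_pbcB_p0B_nonneg hq0 hq1 hx0 hx1 hy0 hy1 (q := q) (x := x) (y := y)
  positivity

/-- **`Θ(r₂) ≥ 0`** for valid `u, s`, `q, x, y, r₂ ∈ [0,1]`. [folklore] -/
theorem sameTwoTheta_nonneg {q x y r₂ : ℝ} (hq0 : 0 ≤ q) (hq1 : q ≤ 1) (hx0 : 0 ≤ x) (hx1 : x ≤ 1) (hy0 : 0 ≤ y) (hy1 : y ≤ 1)
    (hr0 : 0 ≤ r₂) (hr1 : r₂ ≤ 1) {u s : V5} (hu : Valid q u) (hs : Valid q s) : 0 ≤ sameTwoTheta q x y r₂ u s := by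
  rw [sameTwoTheta_split]
  have h0 := sameTwoTheta_zero_nonneg hq0 hq1 hx0 hx1 hy0 hy1 hu hs
  have h1 := sameTwoTheta_one_nonneg hq0 hq1 hx0 hx1 hy0 hy1 hu hs
  have hm := sameTwoThetaMid_nonneg hq0 hq1 hx0 hx1 hy0 hy1 hu hs
  have hr' : 0 ≤ 1 - r₂ := sub_nonneg.2 hr1
  positivity

/-- **TWO `a`-SPOKES TWO RIM VERTICES APART: the Rayleigh difference is `≥ 0`** for valid `u, s` and `q, x, y, r₁, r₂ ∈ [0,1]`. [folklore] -/
theorem rayleigh_sameTwo_nonneg {q x y r₁ r₂ : ℝ} (hq0 : 0 ≤ q) (hq1 : q ≤ 1) (hx0 : 0 ≤ x) (hx1 : x ≤ 1) (hy0 : 0 ≤ y) (hy1 : y ≤ 1)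
    (hr₁0 : 0 ≤ r₁) (hr₁1 : r₁ ≤ 1) (hr₂0 : 0 ≤ r₂) (hr₂1 : r₂ ≤ 1) {u s : V5} (hu : Valid q u) (hs : Valid q s) :
    0 ≤ sameTwoZ q x y r₁ r₂ u s 1 0 * sameTwoZ q x y r₁ r₂ u s 0 1 - sameTwoZ q x y r₁ r₂ u s 1 1 * sameTwoZ q x y r₁ r₂ u s 0 0 :=
  rayleigh_sameTwo_nonneg_of_theta hq0 hq1 hx0 hx1 hy0 hy1 hr₁0 hr₁1 hr₂0 hr₂1 hu hs
    (sameTwoTheta_nonneg hq0 hq1 hx0 hx1 hy0 hy1 hr₂0 hr₂1 hu hs)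

/-- The same for rests in the rim-step closure `InKE q` (prefix / reversed suffix of a double fan with hung three-apex words). [folklore] -/
theorem InKE.rayleigh_sameTwo_nonneg {q x y r₁ r₂ : ℝ} (hq0 : 0 ≤ q) (hq1 : q ≤ 1) (hx0 : 0 ≤ x) (hx1 : x ≤ 1) (hy0 : 0 ≤ y)
    (hy1 : y ≤ 1) (hr₁0 : 0 ≤ r₁) (hr₁1 : r₁ ≤ 1) (hr₂0 : 0 ≤ r₂) (hr₂1 : r₂ ≤ 1) {u s : V5} (hu : InKE q u) (hs : InKE q s) :
    0 ≤ sameTwoZ q x y r₁ r₂ u s 1 0 * sameTwoZ q x y r₁ r₂ u s 0 1 - sameTwoZ q x y r₁ r₂ u s 1 1 * sameTwoZ q x y r₁ r₂ u s 0 0 :=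
  ThreeApex.rayleigh_sameTwo_nonneg hq0 hq1 hx0 hx1 hy0 hy1 hr₁0 hr₁1 hr₂0 hr₂1 (hu.valid hq0 hq1) (hs.valid hq0 hq1)

/-! ### Measure level: the first far pair of the double fan -/

open MeasureTheory Literature.Probability.LatticeModels Literature.Probability.Percolation
open scoped Classical

variable {V : Type*} [Fintype V]

section Setting

variable {a b : V} {c : ℕ → V} {m : ℕ}
variable (hab : a ≠ b) (hinj : ∀ j k, j ≤ m → k ≤ m → c j = c k → j = k) (hca : ∀ j, j ≤ m → c j ≠ a) (hcb : ∀ j, j ≤ m → c j ≠ b)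
include hab hinj hca hcb

omit [Fintype V] in
/-- **The word with the `a`-spokes of `c j` and `c (j+2)` pinned**, through the cut at block `j+2`. [folklore] -/
theorem cut_pin_spokesA_two (q : ℝ) (w : Sym2 V → unitInterval) {j : ℕ} (hj : j + 2 ≤ m) (α β : unitInterval) :
    transferDF q (Function.update (Function.update w s(a, c j) α) s(a, c (j + 2)) β) a b c m =
      sameTwoZ q (wR w s(a, c (j + 1))) (wR w s(b, c (j + 1))) (wR w s(c j, c (j + 1))) (wR w s(c (j + 1), c (j + 2)))
        (conv (edgeBC (wR w s(b, c j))) (blockIn q w a b c j))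
        (conv (restVec q w a b c (j + 2) (m - (j + 2))) (edgeBC (wR w s(b, c (j + 2))))) (α : ℝ) (β : ℝ) := by
  set w₁ := Function.update w s(a, c j) α with hw₁
  set w₂ := Function.update w₁ s(a, c (j + 2)) β with hw₂
  have hj0 : j ≤ m := by omega
  have hj1 : j + 1 ≤ m := by omega
  have hlater1 : ∀ k, j + 2 < k → k ≤ m → ¬ ReadsAt a b c k s(a, c j) := fun k hk hkm hr =>
    absurd ((readsAt_spokeA_iff hab hinj hca hcb hj0 hkm).1 hr) (by omega)
  have hlater2 : ∀ k, j + 2 < k → k ≤ m → ¬ ReadsAt a b c k s(a, c (j + 2)) := fun k hk hkm hr =>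
    absurd ((readsAt_spokeA_iff hab hinj hca hcb hj hkm).1 hr) (by omega)
  have hrest : restVec q w₂ a b c (j + 2) (m - (j + 2)) = restVec q w a b c (j + 2) (m - (j + 2)) := by
    rw [hw₂, restVec_update_eq q w₁ β (m - (j + 2)) (j + 2) (by omega) hlater2, hw₁,
      restVec_update_eq q w α (m - (j + 2)) (j + 2) (by omega) (fun k hk hkm => hlater1 k (by omega) hkm)]
  have hin : blockIn q w₂ a b c j = blockIn q w a b c j := by
    rw [hw₂, blockIn_update_eq q w₁ β (fun k hk hr => absurd ((readsAt_spokeA_iff hab hinj hca hcb hj (by omega)).1 hr) (by omega))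
      (spokeA_ne_axis hab hcb hj) (fun i hi => spokeA_ne_rim hca (j := j + 2) (by omega)),
      hw₁, blockIn_update_eq q w α (fun k hk hr => absurd ((readsAt_spokeA_iff hab hinj hca hcb hj0 (by omega)).1 hr) (by omega))
      (spokeA_ne_axis hab hcb hj0) (fun i hi => hi ▸ spokeA_ne_rim hca (j := i + 1) (hi ▸ hj0))]
  have hα : wR w₂ s(a, c j) = (α : ℝ) := by
    rw [hw₂, wR_update_of_ne w₁ (spokeA_ne_spokeA hinj hj0 hj (by omega)), hw₁, wR_update_self]
  have hβ : wR w₂ s(a, c (j + 2)) = (β : ℝ) := by rw [hw₂, wR_update_self]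
  have hne1 : s(a, c (j + 1)) ≠ s(a, c (j + 2)) := spokeA_ne_spokeA hinj hj1 hj (by omega)
  have hne2 : s(a, c (j + 1)) ≠ s(a, c j) := spokeA_ne_spokeA hinj hj1 hj0 (by omega)
  have hx1 : wR w₂ s(a, c (j + 1)) = wR w s(a, c (j + 1)) := by
    rw [hw₂, wR_update_of_ne w₁ hne1, hw₁, wR_update_of_ne w hne2]
  have hy0 : wR w₂ s(b, c j) = wR w s(b, c j) := by
    rw [hw₂, wR_update_of_ne w₁ (spokeA_ne_spokeB hab hca hj0).symm, hw₁, wR_update_of_ne w (spokeA_ne_spokeB hab hca hj0).symm]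
  have hy1 : wR w₂ s(b, c (j + 1)) = wR w s(b, c (j + 1)) := by
    rw [hw₂, wR_update_of_ne w₁ (spokeA_ne_spokeB hab hca hj1).symm, hw₁, wR_update_of_ne w (spokeA_ne_spokeB hab hca hj1).symm]
  have hy2 : wR w₂ s(b, c (j + 2)) = wR w s(b, c (j + 2)) := by
    rw [hw₂, wR_update_of_ne w₁ (spokeA_ne_spokeB hab hca hj).symm, hw₁, wR_update_of_ne w (spokeA_ne_spokeB hab hca hj).symm]
  have hr0 : wR w₂ s(c j, c (j + 1)) = wR w s(c j, c (j + 1)) := by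
    rw [hw₂, wR_update_of_ne w₁ (spokeA_ne_rim hca (j := j + 2) hj1).symm, hw₁, wR_update_of_ne w (spokeA_ne_rim hca (j := j) hj1).symm]
  have hr1 : wR w₂ s(c (j + 1), c (j + 1 + 1)) = wR w s(c (j + 1), c (j + 2)) := by
    rw [hw₂, wR_update_of_ne w₁ (spokeA_ne_rim hca (j := j + 2) hj).symm, hw₁, wR_update_of_ne w (spokeA_ne_rim hca (j := j) hj).symm]
  rw [transferDF_eq_cut q w₂ a b c hj, zDF_eq_block, hrest, blockIn_succ, zDF_eq_block q w₂ a b c (j + 1), blockIn_succ,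
    zDF_eq_block q w₂ a b c j, hin, hα, hβ, hx1, hy0, hy1, hy2, hr0, hr1]
  -- reassociate: s ∗ (AC β ∗ (BC y₂ ∗ W)) = (s ∗ BC y₂) ∗ (AC β ∗ W)
  simp only [sameTwoZ, ← mul_def]
  rw [mul_left_comm (edgeAC (β : ℝ)) (edgeBC _), ← mul_assoc (restVec q w a b c (j + 2) (m - (j + 2)))]

/-- **TWO `a`-SPOKES AT RIM VERTICES TWO APART ARE NEGATIVELY CORRELATED** in every weighted double fan (`0 < q ≤ 1`, `card V = m + 3`, `w`
supported on the double fan, `j + 2 ≤ m`): `φ(J_{a c_j} ∩ J_{a c_{j+2}}) ≤ φ(J_{a c_j}) φ(J_{a c_{j+2}})` — the first far pair. [cite: Grimmett2006, §3.9 eq. (3.94) (pp. 63–64)] -/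
theorem negCorr_spokesA_two (hcard : Fintype.card V = m + 3) {q : ℝ} (hq0 : 0 < q) (hq1 : q ≤ 1) (w : Sym2 V → unitInterval)
    (hsupp : ∀ e, e ∉ dfPairs a b c m → w e = 0) {j : ℕ} (hj : j + 2 ≤ m) :
    (rcMeasureW w q ∅).real ({ω : BondConfig V | s(a, c j) ∈ ω} ∩ {ω | s(a, c (j + 2)) ∈ ω}) ≤
      (rcMeasureW w q ∅).real {ω : BondConfig V | s(a, c j) ∈ ω} * (rcMeasureW w q ∅).real {ω : BondConfig V | s(a, c (j + 2)) ∈ ω} := by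
  have hj0 : j ≤ m := by omega
  have he : s(a, c j) ∈ dfPairs a b c m := (mem_dfPairs_iff a b c m _).2 (Or.inr (Or.inl ⟨j, hj0, Or.inl rfl⟩))
  have hf : s(a, c (j + 2)) ∈ dfPairs a b c m := (mem_dfPairs_iff a b c m _).2 (Or.inr (Or.inl ⟨j + 2, hj, Or.inl rfl⟩))
  have hne : s(a, c (j + 2)) ≠ s(a, c j) := spokeA_ne_spokeA hinj hj hj0 (by omega)
  set u := conv (edgeBC (wR w s(b, c j))) (blockIn q w a b c j) with hu
  set s := conv (restVec q w a b c (j + 2) (m - (j + 2))) (edgeBC (wR w s(b, c (j + 2)))) with hs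
  have hZ : ∀ α β : unitInterval, rcPartitionFunctionW (Function.update (Function.update w s(a, c j) α) s(a, c (j + 2)) β) q ∅ =
      sameTwoZ q (wR w s(a, c (j + 1))) (wR w s(b, c (j + 1))) (wR w s(c j, c (j + 1))) (wR w s(c (j + 1), c (j + 2))) u s
        (α : ℝ) (β : ℝ) := by
    intro α β
    rw [rcPartitionFunctionW_eq_transferDF hab hinj hca hcb hcard q _
      (supp_update_dfPair _ (supp_update_dfPair w hsupp he α) hf β), cut_pin_spokesA_two hab hinj hca hcb q w hj α β]
  have huK : InKE q u := InKE.step (IsLetter.bc (w _).2.1 (w _).2.2) (inKE_blockIn q w a b c j)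
  have hsK : InKE q s := InKE.mul (inKE_restVec q w a b c (m - (j + 2)) (j + 2)) (by
    rw [← mul_one (edgeBC (wR w s(b, c (j + 2)))), mul_def, one_def]
    exact InKE.step (IsLetter.bc (w _).2.1 (w _).2.2) InKE.base)
  have key := InKE.rayleigh_sameTwo_nonneg (x := wR w s(a, c (j + 1))) (y := wR w s(b, c (j + 1))) (r₁ := wR w s(c j, c (j + 1)))
    (r₂ := wR w s(c (j + 1), c (j + 2))) hq0.le hq1 (w _).2.1 (w _).2.2 (w _).2.1 (w _).2.2 (w _).2.1 (w _).2.2 (w _).2.1 (w _).2.2 huK hsK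
  refine negCorr_of_pinned_rayleigh w hq0 hne ?_
  rw [hZ 1 1, hZ 0 0, hZ 1 0, hZ 0 1]
  simp only [Set.Icc.coe_one, Set.Icc.coe_zero]
  linarith [key]

/-- **Two `b`-spokes at rim vertices two apart are negatively correlated** (the `a ↔ b` relabelling). [cite: Grimmett2006, §3.9 eq. (3.94) (pp. 63–64)] -/
theorem negCorr_spokesB_two (hcard : Fintype.card V = m + 3) {q : ℝ} (hq0 : 0 < q) (hq1 : q ≤ 1) (w : Sym2 V → unitInterval)
    (hsupp : ∀ e, e ∉ dfPairs a b c m → w e = 0) {j : ℕ} (hj : j + 2 ≤ m) :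
    (rcMeasureW w q ∅).real ({ω : BondConfig V | s(b, c j) ∈ ω} ∩ {ω | s(b, c (j + 2)) ∈ ω}) ≤
      (rcMeasureW w q ∅).real {ω : BondConfig V | s(b, c j) ∈ ω} * (rcMeasureW w q ∅).real {ω : BondConfig V | s(b, c (j + 2)) ∈ ω} :=
  negCorr_spokesA_two hab.symm hinj hcb hca hcard hq0 hq1 w (fun e he => hsupp e (by rwa [dfPairs_swap] at he)) hj

end Setting


end ThreeApex

end FK

end Summit.CriticalPhenomena.PercolationContinuityZ3.Theorems
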